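import Summits.Ventures.PercRepro.S2ContractionSeven

/-!
# PercRepro — S2: THE TOP `m`-SETS THROUGH `W` BY THE CONTRACTION LEVER, GRADED BY THE RANK OF THE TRACE (p7, gen 17; sub-claim S2;
the generic form for every corank and every concentrated case)

For a top `m`-set `B` (`ρ(B) = 5`, `E ∖ B` spanning) with trace `T = B ∩ W` of size `j` and outside part `X = B ∖ W` of size `m − j`,
the basis lever (S2ContractionSeven: a basis `J` of `T` has `ρ(J ∪ X) = ρ(B) = 5`, so `J ∪ X` is dependent once `|J| + |X| ≥ 6`, and then
`X` is dependent in `N := M ／ W`) applies exactly when `ρ(T) + (m − j) ≥ 6`. Splitting the traces of each size by that threshold: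
**`ncard_top_le_sum_contract_rank`** —
  `#{top m-sets} ≤ Σ_{j = lo}^{m} ( #{T ⊆ W : |T| = j, ρ(T) + (m − j) ≥ 6}·D_{m−j}(N) + #{T ⊆ W : |T| = j, ρ(T) + (m − j) ≤ 5}·C(|E ∖ W|, m − j) )`
(`D_k(N)` the `N`-dependent `k`-subsets of `E ∖ W`). The instances used so far — `ncard_top_le_sum_contract` (independent traces),
`ncard_top_seven_le_contract`, `ncard_top_eight_le_contract` — are its rows `m = 6, 7, 8`; at corank `d` the rows `m ≤ d` give every
concentrated case `ν = d − 2, d − 3, …` of the row `p = 13` the same way. Axioms: standard.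
-/

open scoped Matroid

namespace PercRepro

namespace S2

open Set

variable {α : Type}

/-- **The top `m`-sets through `W`, graded by the rank of the trace** (see the module docstring). -/
theorem ncard_top_le_sum_contract_rank (M : Matroid α) [M.Finite] {W : Set α} (hW : W ⊆ M.E) (m lo : ℕ)
    (hhit : ∀ B, B ⊆ M.E → B.ncard = m → M.eRk B = 5 → M.eRk (M.E \ B) = M.eRank → lo ≤ (B ∩ W).ncard) :
    {B : Set α | B ⊆ M.E ∧ B.ncard = m ∧ M.eRk B = 5 ∧ M.eRk (M.E \ B) = M.eRank}.ncard ≤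
      ∑ j ∈ Finset.Icc lo m,
        ({T : Set α | T ⊆ W ∧ T.ncard = j ∧ (6 : ℕ∞) ≤ M.eRk T + ((m - j : ℕ) : ℕ∞)}.ncard *
            {X : Set α | X ⊆ M.E \ W ∧ X.ncard = m - j ∧ (M ／ W).Dep X}.ncard +
          {T : Set α | T ⊆ W ∧ T.ncard = j ∧ M.eRk T + ((m - j : ℕ) : ℕ∞) ≤ 5}.ncard * ((M.E \ W).ncard.choose (m - j))) := by
  classical
  set Top := {B : Set α | B ⊆ M.E ∧ B.ncard = m ∧ M.eRk B = 5 ∧ M.eRk (M.E \ B) = M.eRank} with hTop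
  have hWfin : W.Finite := M.ground_finite.subset hW
  have hRfin : (M.E \ W).Finite := M.ground_finite.sdiff
  have hTopfin : Top.Finite := M.ground_finite.finite_subsets.subset (fun B hB => hB.1)
  have hsplit : ∀ B ∈ Top, (B ∩ W).ncard + (B \ W).ncard = m := by
    rintro B ⟨hBE, hBm, -, -⟩
    rw [← hBm]
    exact Set.ncard_inter_add_ncard_sdiff_eq_ncard B W (M.ground_finite.subset hBE)
  -- the lever on a basis `J` of `B ∩ W`
  have hkey : ∀ B ∈ Top, ∀ J : Set α, M.IsBasis J (B ∩ W) → 5 < J.ncard + (B \ W).ncard → (M ／ W).Dep (B \ W) := by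
    rintro B ⟨hBE, hBm, hB5, hBs⟩ J hJ hcard
    have hBfin : B.Finite := M.ground_finite.subset hBE
    have hJW : J ⊆ W := hJ.subset.trans Set.inter_subset_right
    have hJfin : J.Finite := hWfin.subset hJW
    set B'' := J ∪ (B \ W) with hB''
    have hB''E : B'' ⊆ M.E := Set.union_subset (hJW.trans hW) (sdiff_subset.trans hBE)
    have hB''fin : B''.Finite := hJfin.union hBfin.sdiff
    have hr1 : M.eRk B'' ≤ M.eRk B := M.eRk_mono (Set.union_subset (hJ.subset.trans Set.inter_subset_left) sdiff_subset)
    have hB''dep : M.Dep B'' := by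
      rw [← Matroid.eRk_lt_encard_iff_dep_of_finite hB''fin hB''E]
      have hc : B''.encard = ((J.ncard + (B \ W).ncard : ℕ) : ℕ∞) := by
        rw [hB'', Set.encard_union_eq (Set.disjoint_left.2 (fun x hxJ hxB => hxB.2 (hJW hxJ))),
          ← hJfin.cast_ncard_eq, ← hBfin.sdiff.cast_ncard_eq]
        push_cast
        ring
      rw [hc]
      calc M.eRk B'' ≤ M.eRk B := hr1
        _ = 5 := hB5
        _ < ((J.ncard + (B \ W).ncard : ℕ) : ℕ∞) := by exact_mod_cast hcard
    have hinter : B'' ∩ W = J := by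
      ext x
      constructor
      · rintro ⟨hx, hxW⟩
        rcases hx with hxJ | hxB
        · exact hxJ
        · exact absurd hxW hxB.2
      · intro hxJ
        exact ⟨Or.inl hxJ, hJW hxJ⟩
    have hsd : B'' \ W = B \ W := by
      ext x
      constructor
      · rintro ⟨hx, hxW⟩
        rcases hx with hxJ | hxB
        · exact absurd (hJW hxJ) hxW
        · exact hxB
      · intro hx
        exact ⟨Or.inr hx, hx.2⟩
    have := contract_dep_sdiff_of_dep_of_indep_inter M hW hB''E hB''dep (hinter ▸ hJ.indep)
    rwa [hsd] at this
  -- the classes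
  let A : ℕ → Set (Set α) := fun j => {B ∈ Top | (B ∩ W).ncard = j ∧ (6 : ℕ∞) ≤ M.eRk (B ∩ W) + ((m - j : ℕ) : ℕ∞)}
  let C : ℕ → Set (Set α) := fun j => {B ∈ Top | (B ∩ W).ncard = j ∧ M.eRk (B ∩ W) + ((m - j : ℕ) : ℕ∞) ≤ 5}
  have hcover : Top ⊆ ⋃ j ∈ Finset.Icc lo m, (A j ∪ C j) := by
    intro B hB
    obtain ⟨hBE, hBm, hB5, hBs⟩ := hB
    have hBfin : B.Finite := M.ground_finite.subset hBE
    have hj1 : lo ≤ (B ∩ W).ncard := hhit B hBE hBm hB5 hBs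
    have hj2 : (B ∩ W).ncard ≤ m := hBm ▸ Set.ncard_le_ncard Set.inter_subset_left hBfin
    refine Set.mem_iUnion₂.2 ⟨(B ∩ W).ncard, Finset.mem_Icc.2 ⟨hj1, hj2⟩, ?_⟩
    rcases le_or_gt (M.eRk (B ∩ W) + ((m - (B ∩ W).ncard : ℕ) : ℕ∞)) 5 with hle | hlt
    · exact Or.inr ⟨⟨hBE, hBm, hB5, hBs⟩, rfl, hle⟩
    · refine Or.inl ⟨⟨hBE, hBm, hB5, hBs⟩, rfl, ?_⟩
      have := Order.add_one_le_of_lt hlt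
      rwa [show (5 : ℕ∞) + 1 = 6 by norm_num] at this
  -- the lever class, injected into a product
  have hA : ∀ j, (A j).ncard ≤ {T : Set α | T ⊆ W ∧ T.ncard = j ∧ (6 : ℕ∞) ≤ M.eRk T + ((m - j : ℕ) : ℕ∞)}.ncard *
      {X : Set α | X ⊆ M.E \ W ∧ X.ncard = m - j ∧ (M ／ W).Dep X}.ncard := by
    intro j
    rw [← Set.ncard_prod]
    refine Set.ncard_le_ncard_of_injOn (fun B : Set α => (B ∩ W, B \ W)) ?_ ?_
      ((hWfin.finite_subsets.subset (fun T hT => hT.1)).prod (hRfin.finite_subsets.subset (fun X hX => hX.1)))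
    · rintro B ⟨hB, hj, hr⟩
      have hBE : B ⊆ M.E := hB.1
      have hs := hsplit B hB
      have hTE : B ∩ W ⊆ M.E := Set.inter_subset_left.trans hBE
      obtain ⟨J, hJ⟩ := M.exists_isBasis (B ∩ W) hTE
      have hJc : 5 < J.ncard + (B \ W).ncard := by
        have h := hJ.encard_eq_eRk
        rw [← (hWfin.subset (hJ.subset.trans Set.inter_subset_right)).cast_ncard_eq] at h
        rw [← h] at hr
        have : ((6 : ℕ) : ℕ∞) ≤ ((J.ncard + (m - j) : ℕ) : ℕ∞) := by push_cast; exact hr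
        have h6 : 6 ≤ J.ncard + (m - j) := by exact_mod_cast this
        omega
      refine Set.mem_prod.2 ⟨⟨Set.inter_subset_right, hj, hr⟩, ⟨sdiff_subset_sdiff_left hBE, ?_, hkey B hB J hJ hJc⟩⟩
      show (B \ W).ncard = m - j
      omega
    · rintro B₁ - B₂ - hEq
      simp only [Prod.mk.injEq] at hEq
      rw [← Set.inter_union_sdiff B₁ W, ← Set.inter_union_sdiff B₂ W, hEq.1, hEq.2]
  -- the crude class
  have hC : ∀ j, (C j).ncard ≤ {T : Set α | T ⊆ W ∧ T.ncard = j ∧ M.eRk T + ((m - j : ℕ) : ℕ∞) ≤ 5}.ncard *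
      ((M.E \ W).ncard.choose (m - j)) := by
    intro j
    rw [← ncard_subsets_ncard_eq (M.E \ W) hRfin (m - j), ← Set.ncard_prod]
    refine Set.ncard_le_ncard_of_injOn (fun B : Set α => (B ∩ W, B \ W)) ?_ ?_
      ((hWfin.finite_subsets.subset (fun T hT => hT.1)).prod (hRfin.finite_subsets.subset (fun X hX => hX.1)))
    · rintro B ⟨hB, hj, hr⟩
      have hBE : B ⊆ M.E := hB.1
      have hs := hsplit B hB
      refine Set.mem_prod.2 ⟨⟨Set.inter_subset_right, hj, hr⟩, ⟨sdiff_subset_sdiff_left hBE, ?_⟩⟩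
      show (B \ W).ncard = m - j
      omega
    · rintro B₁ - B₂ - hEq
      simp only [Prod.mk.injEq] at hEq
      rw [← Set.inter_union_sdiff B₁ W, ← Set.inter_union_sdiff B₂ W, hEq.1, hEq.2]
  calc Top.ncard ≤ (⋃ j ∈ Finset.Icc lo m, (A j ∪ C j)).ncard :=
        Set.ncard_le_ncard hcover (Set.Finite.biUnion (Finset.Icc lo m).finite_toSet
          (fun j _ => (hTopfin.subset (fun B hB => hB.1)).union (hTopfin.subset (fun B hB => hB.1))))
    _ ≤ ∑ j ∈ Finset.Icc lo m, (A j ∪ C j).ncard := Finset.set_ncard_biUnion_le _ _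
    _ ≤ ∑ j ∈ Finset.Icc lo m, ((A j).ncard + (C j).ncard) :=
        Finset.sum_le_sum (fun j _ => Set.ncard_union_le _ _)
    _ ≤ _ := Finset.sum_le_sum (fun j _ => Nat.add_le_add (hA j) (hC j))

end S2

end PercRepro
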